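import Summits.BirchSwinnertonDyer.BirchSwinnertonDyer.Theorems.EisensteinPrimesBSDpOnCellCTelescopeK2GenericFibreZero
import Literature.NumberTheory.EllipticCurves.CharacterModuleQuotientDualityProofs
import Literature.NumberTheory.IwasawaTheory.Greenberg2006.CofiniteGenerationCriterion
import Literature.NumberTheory.EllipticCurves.BigGaloisRepSelmer
import HarnessLib

/-!
# Crux 4 `BSDpOnCellC` (stmt-BirchSwinnertonDyer-19034), line `telescope`, leaves N2′/N3′ — road (a′) of the `S₀`-residual, DUALITY HALF:
# a family of `Λ`-linear automorphisms of a cofinitely generated discrete `Λ = ℤ_p⟦X⟧`-module `A` that moves every fibre `A[X − x_k]`,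
# `k` in an infinite set of distinct `x_k ∈ 𝔪`, inside a FINITE set acts trivially on `f·A` for one regular `f`, and then the defect
# `A^G/θ·A^G` is finite at every `θ = X − C c` dividing `A` — the per-prime input (fin_w) of p758349
# (helper, `--supports stmt-BirchSwinnertonDyer-19034 --as helper`; closes nothing)

Cell `bsd-eis`, width seat `bsd-line-x2-p2` (prover g21, 2026-08-30; D-0154 KEY row 5). THEOREMS ONLY: no definition, no named fact,
no `sorry`, no instance, no notation. Memo `ROAD-A-PRICING-x2p2g21.md` §3 (evidence #46 on -19034), steps 1, 3, 5 on Mathlib's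
`CharacterModule` with the tree's Pontryagin dictionary (`PontryaginCard.exists_eq_smul_of_forall_ker`,
`PontryaginCard.finite_of_finite_characterModule`, `Greenberg2016.isCofinitelyGenerated_iff_module_finite_characterModule`,
`IsCofinitelyGenerated.submodule`) and the algebra half `TelescopeK2GenericFibreZero` (this seat, file A):

* §1 `torsionBy_characterModule_eq_bot_of_divisible` (`A` `θ`-divisible ⇒ `A^∨[θ] = 0`), **`exists_nsmul_dual_eq_smul`** (if
  `φ(A[θ])` is finite then every `χ ∘ φ` satisfies `n • (χ ∘ φ) ∈ θ • A^∨` with `n ≠ 0` — the fibre condition of file A §2,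
  dualised; injectivity of `ℚ/ℤ`, no divisibility needed).
* §2 **`exists_mem_nonZeroDivisors_forall_apply_smul_eq`** — `A` cofinitely generated, `g_i ∈ End_Λ(A)` (any family), `S ⊆ 𝔪`
  infinite with `(g_i − 1)(A[θ_c])` finite for all `c ∈ S`, `i` ⇒ **`∃ f ∈ Λ⁰, ∀ i a, g_i (f • a) = f • a`**
  (each `(g_i − 1)^∨ A^∨ ⊆ A^∨_tors` by file A §2; one regular annihilator of `A^∨_tors`; characters separate points).
* §3 **`finite_quotient_of_forall_smul_mem`** — `A` cofinitely generated, `M ≤ A` a submodule containing `f·A` for a regular `f`,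
  `A` `θ_c`-divisible ⇒ `M/θ_c·M` is FINITE (`M^∨ = A^∨/K` with `K ⊆ A^∨_tors`; file A §3; `(M/θM)^∨ ↪ M^∨[θ]`).
* §4 `exists_pow_smul_eq_of_finite_quotient` — for `p`-primary `A`, finiteness of `M/θ·M` in the `p`-power form
  «`∃ n, ∀ a ∈ M, ∃ a₀ ∈ M, θ • a₀ = p^n • a`».
* §5 **`exists_pow_inertiaDefect_of_fibres`** — the shape consumed by p758349 `…WeightTwoControlMapOfFiniteDefect`: for
  `ρ₂ : Γ_K → Aut_{ℤ_p⟦X⟧}(A₂)` with `A₂` cofinitely generated and `p`-primary, a place `w`, a sequence `x : ℕ → ℤ_p` with `‖x k‖ < 1`,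
  an infinite set of values `x '' 𝒦`, `θ`-divisibility of the target fibre `θ = X − C c` ((cof₀) at `c = 0`), and the FIBRE
  CONDITION «for `k ∈ 𝒦` and every `h ∈ I_w`, `(ρ₂(h) − 1)(A₂[X − C x_k])` is finite» (which (fd_k) gives when `I_w` acts trivially on
  the member `A_{g_k}†`, `w ∤ (N/p)·p`): **(fin_w)** `∃ n, ∀ a ∈ A₂^{I_w}, ∃ a₀ ∈ A₂^{I_w}, X•a₀ = p^n•a`, AND the same at every fibre
  `X − C x_k` (the member defects (fin_{w,k}), all `k`).

So, BY NAME: W2's S₀-residual (fin_w) at a ramified `w ∤ N·p` follows from FD + (dist) «infinitely many distinct `x_k`» + the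
unramifiedness of the displayed fibres at `w` (memo §1 shows that «ρ₂ unramified at w» itself does NOT follow). Nothing about any curve
is asserted; the member/curve unramifiedness enters §5 only as the abstract fibre condition.

HONEST FRAMING: module theory + Pontryagin duality; no registered stub, crux or summit statement is proved by this file; closes: none.

References: [GreenbergLNM1716] §4 pp. 98, 117; [Greenberg2006] §3 A (Props. 3.1–3.2); [Greenberg2016Selmer] §1 p. 2 (Pontryagin duals);
[Tate1966Bourbaki] §5 Lemma z.3; [Washington1997] §13.2.
-/

noncomputable section

-- D-0017: single-problem summit, the namespace repeats the problem name by design.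
set_option linter.dupNamespace false
set_option autoImplicit false

open Literature.NumberTheory.EllipticCurves Literature.NumberTheory.EllipticCurves.IwasawaAlgebra
open Literature.NumberTheory.IwasawaTheory Literature.NumberTheory.IwasawaTheory.Greenberg2006
open scoped Pointwise

namespace Summit.BirchSwinnertonDyer.BirchSwinnertonDyer.Theorems.TelescopeK2InertiaDefectFiniteOfFibres

variable {p : ℕ} [Fact p.Prime]

/-! ## §1 Duality plumbing on `A^∨ = CharacterModule A` -/

/-- If `A` is `θ`-divisible then `A^∨` has no `θ`-torsion. [cite: Greenberg2006, §2 A (p. 348 L4–6)] -/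
theorem torsionBy_characterModule_eq_bot_of_divisible {Λ : Type*} [CommRing Λ] {A : Type*} [AddCommGroup A] [Module Λ A]
    (θ : Λ) (hdiv : ∀ a : A, ∃ b : A, θ • b = a) :
    Submodule.torsionBy Λ (CharacterModule A) θ = ⊥ := by
  rw [eq_bot_iff]
  intro χ hχ
  rw [Submodule.mem_torsionBy_iff] at hχ
  rw [Submodule.mem_bot]
  refine CharacterModule.ext _ fun a => ?_
  obtain ⟨b, rfl⟩ := hdiv a
  have := DFunLike.congr_fun hχ b
  rwa [CharacterModule.smul_apply] at this

/-- **The fibre condition, dualised.** If the `Λ`-linear `φ` maps `A[θ]` into a FINITE set, then for every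
character `χ` some non-zero multiple of `χ ∘ φ` is divisible by `θ` in `A^∨`: `n • φ^∨χ = θ • ψ`. (The character `n • χ ∘ φ`, `n` the
order of the finite group through which `φ|_{A[θ]}` factors, kills `A[θ] = ker(θ·)`, hence is `ψ ∘ (θ·)` by the injectivity of `ℚ/ℤ`;
no divisibility is needed.)
[cite: Tate1966Bourbaki, §5 Lemma z.3] [cite: GreenbergLNM1716, §4 p. 98] -/
theorem exists_nsmul_dual_eq_smul {Λ : Type*} [CommRing Λ] {A : Type*} [AddCommGroup A] [Module Λ A]
    (φ : A →ₗ[Λ] A) (θ : Λ)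
    (hfin : Set.Finite (φ '' {a : A | θ • a = 0})) (χ : CharacterModule A) :
    ∃ n : ℕ, n ≠ 0 ∧ ∃ ψ : CharacterModule A, (n : Λ) • CharacterModule.dual φ χ = θ • ψ := by
  classical
  -- the finite submodule `φ(A[θ])` and its cardinality `n`
  let N : Submodule Λ A := (Submodule.torsionBy Λ A θ).map φ
  have hNfin : (N : Set A).Finite := by
    refine hfin.subset ?_
    rintro _ ⟨a, ha, rfl⟩
    exact ⟨a, (Submodule.mem_torsionBy_iff θ a).1 ha, rfl⟩
  haveI : Finite N := hNfin.to_subtype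
  set n : ℕ := Nat.card N with hn
  have hn0 : n ≠ 0 := Nat.card_pos.ne'
  refine ⟨n, hn0, ?_⟩
  -- `n • (χ ∘ φ)` kills `ker (θ·)`
  have hkill : ∀ s : A, θ • s = 0 → ((n : Λ) • CharacterModule.dual φ χ) s = 0 := by
    intro s hs
    have hmem : φ s ∈ N := Submodule.mem_map_of_mem ((Submodule.mem_torsionBy_iff θ s).2 hs)
    have hns : n • φ s = 0 := by
      have := card_nsmul_eq_zero' (G := N) (x := ⟨φ s, hmem⟩)
      exact congrArg Subtype.val this
    rw [CharacterModule.smul_apply, CharacterModule.dual_apply, Nat.cast_smul_eq_nsmul]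
    change χ (φ (n • s)) = 0
    rw [map_nsmul, hns, map_zero]
  obtain ⟨ψ, hψ⟩ := PontryaginCard.exists_eq_smul_of_forall_ker (R := Λ) (X := CharacterModule A) (S := A)
    (AddMonoidHom.id _) Function.bijective_id θ (DistribSMul.toAddMonoidHom A θ) (fun x s => rfl) hkill
  exact ⟨ψ, hψ⟩

/-! ## §2 Inertia acts trivially on `f·A` for one regular `f` -/

/-- **Fibrewise-finite automorphisms act trivially on `f·A`.** `A` a cofinitely generated discrete `Λ`-module (`Λ = ℤ_p⟦X⟧`), `g_i`
a family of `Λ`-linear endomorphisms, `S ⊆ 𝔪_{ℤ_p}` infinite such that for every `c ∈ S` the set `(g_i − 1)(A[θ_c])` is finite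
for every `i`. Then ONE regular `f ∈ Λ` satisfies `g_i (f • a) = f • a` for all `i, a` (each `(g_i − 1)^∨(A^∨) ⊆ A^∨_tors` by
`TelescopeK2GenericFibreZero.mem_torsion_of_forall_nsmul_mem`; `f` a regular annihilator of `A^∨_tors`; characters separate points).
[cite: GreenbergLNM1716, §4 p. 117] [cite: Greenberg2006, §3 A (Props. 3.1–3.2)] -/
theorem exists_mem_nonZeroDivisors_forall_apply_smul_eq {A : Type} [AddCommGroup A] [Module (IwasawaAlgebra p) A]
    (hA : IsCofinitelyGenerated (IwasawaAlgebra p) A)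
    {ι : Type*} (g : ι → (A →ₗ[IwasawaAlgebra p] A))
    {S : Set ℤ_[p]} (hS : S.Infinite) (hS𝔪 : S ⊆ IsLocalRing.maximalIdeal ℤ_[p])
    (hfib : ∀ c ∈ S, ∀ i : ι, Set.Finite ((fun a => g i a - a) '' {a : A | (PowerSeries.X - PowerSeries.C c : IwasawaAlgebra p) • a = 0})) :
    ∃ f : IwasawaAlgebra p, f ∈ nonZeroDivisors (IwasawaAlgebra p) ∧ ∀ (i : ι) (a : A), g i (f • a) = f • a := by
  classical
  haveI : Module.Finite (IwasawaAlgebra p) (CharacterModule A) :=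
    (isCofinitelyGenerated_iff_module_finite_characterModule.1 hA)
  haveI : IsNoetherian (IwasawaAlgebra p) (CharacterModule A) := isNoetherian_of_isNoetherianRing_of_finite _ _
  haveI : Module.Finite (IwasawaAlgebra p) (Submodule.torsion (IwasawaAlgebra p) (CharacterModule A)) :=
    Module.IsNoetherian.finite _ _
  -- every `(g_i − 1)^∨ χ` is torsion
  let φ : ι → (A →ₗ[IwasawaAlgebra p] A) := fun i => g i - LinearMap.id
  have hφ : ∀ (i : ι) (a : A), φ i a = g i a - a := fun i a => rfl
  have htors : ∀ (i : ι) (χ : CharacterModule A),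
      CharacterModule.dual (φ i) χ ∈ Submodule.torsion (IwasawaAlgebra p) (CharacterModule A) := by
    intro i χ
    refine TelescopeK2GenericFibreZero.mem_torsion_of_forall_nsmul_mem hS hS𝔪 _ fun c hc => ?_
    have hfin : Set.Finite ((φ i) '' {a : A | (PowerSeries.X - PowerSeries.C c : IwasawaAlgebra p) • a = 0}) := by
      refine (hfib c hc i).subset ?_
      rintro _ ⟨a, ha, rfl⟩
      exact ⟨a, ha, (hφ i a).symm⟩
    exact exists_nsmul_dual_eq_smul (φ i) _ hfin χ
  -- one regular annihilator of the torsion submodule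
  obtain ⟨f, hfann, hf0⟩ := Submodule.annihilator_top_inter_nonZeroDivisors (R := IwasawaAlgebra p)
    (M := Submodule.torsion (IwasawaAlgebra p) (CharacterModule A)) (Submodule.torsion_isTorsion)
  refine ⟨f, hf0, fun i a => ?_⟩
  -- characters separate points: `χ ((g_i − 1)(f • a)) = (f • (g_i − 1)^∨ χ) a = 0`
  have hzero : φ i (f • a) = 0 := by
    refine CharacterModule.eq_zero_of_character_apply fun χ => ?_
    have h1 : f • CharacterModule.dual (φ i) χ = 0 := by
      have := Submodule.mem_annihilator.1 hfann ⟨_, htors i χ⟩ Submodule.mem_top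
      exact congrArg Subtype.val this
    have h2 := DFunLike.congr_fun h1 a
    rw [CharacterModule.smul_apply, CharacterModule.dual_apply] at h2
    exact h2
  rw [hφ, sub_eq_zero] at hzero
  exact hzero

/-! ## §3 The defect `M/θM` is finite for `M ⊇ f·A` -/

/-- **`M/θ·M` is finite** for a submodule `M` of a cofinitely generated `A` containing `f·A` (`f` regular) and `θ = X − C c` (`c ∈ 𝔪`)
dividing `A`: dually `M^∨ = A^∨/K` with `K ⊆ A^∨_tors` (a character vanishing on `M ⊇ f·A` is killed by `f`), `A^∨[θ] = 0`, so
`M^∨[θ]` is finite (`TelescopeK2GenericFibreZero.finite_torsionBy_quotient_of_le_torsion`) and `(M/θM)^∨ ↪ M^∨[θ]`.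
[cite: Greenberg2006, §3 A (Props. 3.1–3.2)] [cite: GreenbergLNM1716, §4 p. 117] [cite: Washington1997, §13.2] -/
theorem finite_quotient_of_forall_smul_mem {A : Type} [AddCommGroup A] [Module (IwasawaAlgebra p) A]
    (hA : IsCofinitelyGenerated (IwasawaAlgebra p) A)
    (M : Submodule (IwasawaAlgebra p) A) {f : IwasawaAlgebra p} (hf : f ∈ nonZeroDivisors (IwasawaAlgebra p))
    (hfM : ∀ a : A, f • a ∈ M) {c : ℤ_[p]} (hc : c ∈ IsLocalRing.maximalIdeal ℤ_[p])
    (hdiv : ∀ a : A, ∃ b : A, (PowerSeries.X - PowerSeries.C c : IwasawaAlgebra p) • b = a) :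
    Finite (QuotSMulTop (PowerSeries.X - PowerSeries.C c : IwasawaAlgebra p) M) := by
  classical
  set θ : IwasawaAlgebra p := PowerSeries.X - PowerSeries.C c with hθdef
  haveI : Module.Finite (IwasawaAlgebra p) (CharacterModule A) :=
    (isCofinitelyGenerated_iff_module_finite_characterModule.1 hA)
  -- restriction of characters `A^∨ → M^∨` is onto; its kernel lies in the torsion
  let res : CharacterModule A →ₗ[IwasawaAlgebra p] CharacterModule M := CharacterModule.dual M.subtype
  have hres : Function.Surjective res := CharacterModule.dual_surjective_of_injective _ M.injective_subtype
  have hK : LinearMap.ker res ≤ Submodule.torsion (IwasawaAlgebra p) (CharacterModule A) := by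
    intro χ hχ
    rw [LinearMap.mem_ker] at hχ
    refine (Submodule.mem_torsion_iff χ).2 ⟨⟨f, hf⟩, ?_⟩
    change f • χ = 0
    refine CharacterModule.ext _ fun a => ?_
    rw [CharacterModule.smul_apply]
    have := DFunLike.congr_fun hχ ⟨f • a, hfM a⟩
    rw [CharacterModule.dual_apply] at this
    exact this
  -- `(A^∨/K)[θ]` is finite (file A §3), hence so is `M^∨[θ]`
  have hT : Submodule.torsionBy (IwasawaAlgebra p) (CharacterModule A) θ = ⊥ :=
    torsionBy_characterModule_eq_bot_of_divisible θ hdiv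
  haveI hfinQ := TelescopeK2GenericFibreZero.finite_torsionBy_quotient_of_le_torsion (LinearMap.ker res) hK hc hT
  let e : (CharacterModule A ⧸ LinearMap.ker res) ≃ₗ[IwasawaAlgebra p] CharacterModule M :=
    res.quotKerEquivOfSurjective hres
  have hfinM : Finite (Submodule.torsionBy (IwasawaAlgebra p) (CharacterModule M) θ) := by
    refine Finite.of_injective (fun x : Submodule.torsionBy (IwasawaAlgebra p) (CharacterModule M) θ =>
      (⟨e.symm x, by
        have hx := (Submodule.mem_torsionBy_iff θ (x : CharacterModule M)).1 x.2
        rw [Submodule.mem_torsionBy_iff, ← map_smul, hx, map_zero]⟩ :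
        Submodule.torsionBy (IwasawaAlgebra p) (CharacterModule A ⧸ LinearMap.ker res) θ)) ?_
    intro x y hxy
    have := congrArg (fun z : Submodule.torsionBy (IwasawaAlgebra p) (CharacterModule A ⧸ LinearMap.ker res) θ =>
      e (z : CharacterModule A ⧸ LinearMap.ker res)) hxy
    simp only [LinearEquiv.apply_symm_apply] at this
    exact Subtype.ext this
  -- `(M/θM)^∨ ↪ M^∨[θ]`
  let Q := QuotSMulTop θ M
  let j : CharacterModule Q →ₗ[IwasawaAlgebra p] CharacterModule M := CharacterModule.dual (θ • (⊤ : Submodule _ M)).mkQ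
  have hj : Function.Injective j := CharacterModule.dual_injective_of_surjective _ (Submodule.mkQ_surjective _)
  have hjmem : ∀ χ : CharacterModule Q, j χ ∈ Submodule.torsionBy (IwasawaAlgebra p) (CharacterModule M) θ := by
    intro χ
    rw [Submodule.mem_torsionBy_iff]
    refine CharacterModule.ext _ fun m => ?_
    rw [CharacterModule.smul_apply]
    change χ ((θ • (⊤ : Submodule _ M)).mkQ (θ • m)) = 0
    have h0 : (θ • (⊤ : Submodule (IwasawaAlgebra p) M)).mkQ (θ • m) = 0 := by
      rw [Submodule.mkQ_apply, Submodule.Quotient.mk_eq_zero]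
      exact Submodule.smul_mem_pointwise_smul m θ ⊤ Submodule.mem_top
    rw [h0, map_zero]
  haveI : Finite (CharacterModule Q) :=
    Finite.of_injective (fun χ => (⟨j χ, hjmem χ⟩ : Submodule.torsionBy (IwasawaAlgebra p) (CharacterModule M) θ))
      fun x y hxy => hj (congrArg Subtype.val hxy)
  exact PontryaginCard.finite_of_finite_characterModule Q

/-! ## §4 The `p`-power form -/

/-- For a `p`-primary module, finiteness of `M/θ·M` in the form «one power of `p` pushes `M` into `θ·M`».
[cite: JetchevSkinnerWan2017, Lemma 3.4.1 (arXiv:1512.06894 p. 14)] -/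
theorem exists_pow_smul_eq_of_finite_quotient {Λ : Type*} [CommRing Λ] {A : Type*} [AddCommGroup A] [Module Λ A]
    (q : Λ) (hprim : ∀ a : A, ∃ k : ℕ, q ^ k • a = 0) (M : Submodule Λ A) (θ : Λ)
    [Finite (QuotSMulTop θ M)] :
    ∃ n : ℕ, ∀ a ∈ M, ∃ a₀ ∈ M, θ • a₀ = q ^ n • a := by
  classical
  haveI : Fintype (QuotSMulTop θ M) := Fintype.ofFinite _
  have hcl : ∀ x : QuotSMulTop θ M, ∃ k : ℕ, q ^ k • x = 0 := by
    intro x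
    obtain ⟨m, rfl⟩ := Submodule.Quotient.mk_surjective _ x
    obtain ⟨k, hk⟩ := hprim (m : A)
    refine ⟨k, ?_⟩
    rw [← Submodule.Quotient.mk_smul, show q ^ k • m = 0 from Subtype.ext (by simpa using hk), Submodule.Quotient.mk_zero]
  choose k hk using hcl
  refine ⟨Finset.univ.sup k, fun a ha => ?_⟩
  set x : QuotSMulTop θ M := Submodule.Quotient.mk ⟨a, ha⟩ with hx
  have hxk : q ^ (Finset.univ.sup k) • x = 0 := by
    obtain ⟨d, hd⟩ := Nat.exists_eq_add_of_le (Finset.le_sup (f := k) (Finset.mem_univ x))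
    rw [hd, pow_add, mul_comm, mul_smul, hk x, smul_zero]
  rw [hx, ← Submodule.Quotient.mk_smul, Submodule.Quotient.mk_eq_zero, Submodule.mem_smul_pointwise_iff_exists] at hxk
  obtain ⟨m₀, -, hm₀⟩ := hxk
  refine ⟨(m₀ : A), m₀.2, ?_⟩
  have := congrArg Subtype.val hm₀
  simpa using this

/-! ## §5 Assembly: (fin_w) and (fin_{w,k}) for `ρ₂` from the fibre condition on an infinite set of distinct fibres -/

/-- Values of `x : ℕ → ℤ_p` with `‖x k‖ < 1` lie in `𝔪_{ℤ_p}`. [folklore] -/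
theorem image_subset_maximalIdeal {x : ℕ → ℤ_[p]} (hx : ∀ k, ‖x k‖ < 1) (𝒦 : Set ℕ) :
    x '' 𝒦 ⊆ (IsLocalRing.maximalIdeal ℤ_[p] : Set ℤ_[p]) := by
  rintro _ ⟨k, -, rfl⟩
  exact PadicInt.mem_nonunits.2 (hx k)

/-- **(fin) FROM THE FIBRE CONDITION.** `ρ₂ : Γ → Aut_{ℤ_p⟦X⟧}(A₂)` on a cofinitely generated `p`-primary discrete module, a family of
elements `ι : H → Γ` (the inertia group at `w`), `x : ℕ → ℤ_p` with `‖x k‖ < 1`, an infinite set `𝒦` on which `x` is injective,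
`(X − C x_k)`-divisibility for `k ∈ 𝒦` and `θ`-divisibility for the target fibre `θ = X − C c` (`c ∈ 𝔪`; `c = 0` is (cof₀), `c = x_k` is
(cof_k)), and the FIBRE CONDITION «`(ρ₂(ι h) − 1)(A₂[X − C x_k])` finite for `k ∈ 𝒦`, `h ∈ H`». THEN `∃ n, ∀ a ∈ A₂^{H}, ∃ a₀ ∈ A₂^{H},
θ•a₀ = p^n•a` — at `c = 0` the hypothesis (fin_w) of p758349 `TelescopeK2WeightTwoControlMapOfFiniteDefect.exists_weightTwoControlMap_of_finiteDefect`.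
[cite: GreenbergLNM1716, §4 p. 117] [cite: Greenberg2006, §3 A (Props. 3.1–3.2)] [cite: JetchevSkinnerWan2017, Lemma 3.4.1] -/
theorem exists_pow_inertiaDefect_of_fibres {Γ : Type*} [Group Γ] [TopologicalSpace Γ]
    [TopologicalSpace (PowerSeries ℤ_[p])] {A₂ : Type} [AddCommGroup A₂] [Module (PowerSeries ℤ_[p]) A₂] [TopologicalSpace A₂]
    (ρ₂ : Literature.NumberTheory.GaloisRepresentations.ContinuousRep Γ (PowerSeries ℤ_[p]) A₂)
    (hA : IsCofinitelyGenerated (PowerSeries ℤ_[p]) A₂)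
    (hprim : ∀ a : A₂, ∃ k : ℕ, (p : PowerSeries ℤ_[p]) ^ k • a = 0)
    {H : Type*} (ι : H → Γ)
    (x : ℕ → ℤ_[p]) (hx : ∀ k, ‖x k‖ < 1) (𝒦 : Set ℕ) (h𝒦 : (x '' 𝒦).Infinite)
    (hfib : ∀ k ∈ 𝒦, ∀ h : H,
      Set.Finite ((fun a => ρ₂ (ι h) a - a) '' {a : A₂ | (PowerSeries.X - PowerSeries.C (x k)) • a = 0}))
    {c : ℤ_[p]} (hc : c ∈ IsLocalRing.maximalIdeal ℤ_[p])
    (hdivc : ∀ a : A₂, ∃ b : A₂, (PowerSeries.X - PowerSeries.C c) • b = a) :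
    ∃ n : ℕ, ∀ a : A₂, (∀ h : H, ρ₂ (ι h) a = a) →
      ∃ a₀ : A₂, (∀ h : H, ρ₂ (ι h) a₀ = a₀) ∧
        (PowerSeries.X - PowerSeries.C c) • a₀ = ((p : PowerSeries ℤ_[p]) ^ n) • a := by
  classical
  -- §2: one regular `f` with `I_w` trivial on `f·A₂`
  obtain ⟨f, hf, hfix⟩ := exists_mem_nonZeroDivisors_forall_apply_smul_eq (p := p) hA
    (fun h : H => (ρ₂ (ι h) : A₂ →ₗ[PowerSeries ℤ_[p]] A₂)) h𝒦 (image_subset_maximalIdeal hx 𝒦)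
    (by rintro _ ⟨k, hk, rfl⟩ h; exact hfib k hk h)
  -- the invariants submodule
  let M : Submodule (PowerSeries ℤ_[p]) A₂ :=
    { carrier := {a | ∀ h : H, ρ₂ (ι h) a = a}
      add_mem' := fun {a b} ha hb h => by rw [map_add, ha h, hb h]
      zero_mem' := fun h => map_zero _
      smul_mem' := fun r a ha h => by rw [map_smul, ha h] }
  have hfM : ∀ a : A₂, f • a ∈ M := fun a h => hfix h a
  -- §3 + §4
  haveI := finite_quotient_of_forall_smul_mem (p := p) hA M hf hfM hc hdivc
  obtain ⟨n, hn⟩ := exists_pow_smul_eq_of_finite_quotient (p : PowerSeries ℤ_[p]) hprim M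
    (PowerSeries.X - PowerSeries.C c)
  refine ⟨n, fun a ha => ?_⟩
  obtain ⟨a₀, ha₀, h⟩ := hn a ha
  exact ⟨a₀, ha₀, h⟩

end Summit.BirchSwinnertonDyer.BirchSwinnertonDyer.Theorems.TelescopeK2InertiaDefectFiniteOfFibres

end
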